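import Mathlib.LinearAlgebra.LinearIndependent.Lemmas
import Literature.AlgebraicGeometry.Motives.Lefschetz
import Literature.AlgebraicGeometry.Motives.LefschetzStarProofs
import HarnessLib

/-!
# Discharged fact: the Lefschetz decomposition (`lefschetz_decomposition`)

`Literature.AlgebraicGeometry.Motives.Lefschetz` records as a named fact (D-0014)
`Literature.AlgebraicGeometry.Motives.WeilCohomology.lefschetz_decomposition : Prop` — for a Weil
cohomology theory `W` with the hard Lefschetz property, `X` smooth projective of dimension `n` and
`η` a hyperplane class, every `Hⁱ(X)` is the internal direct sum `⨁_{a + 2b = i} Lᵇ Pᵃ(X)` of the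
images of the primitive parts `Pᵃ(X) = {x ∈ Hᵃ | Lⁿ⁻ᵃ⁺¹ x = 0}` (`Pᵃ = 0` for `a > n`) under the
iterated Lefschetz operators, citing S. Kleiman, *Algebraic cycles and the Weil conjectures*
(1968), §1.4 (1.4.1). This file **proves** it (`WeilCohomology.lefschetz_decomposition_holds`).

## The argument

Pure linear algebra from hard Lefschetz, as printed in C. Voisin, *Hodge theory and complex
algebraic geometry I* (2002), Prop. 6.22 and Cor. 6.26 ("by the same argument as in the case of
forms"): existence and uniqueness of `α = ∑ᵣ Lʳ αᵣ` by induction on the degree, reducing degrees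
`k > n` to `2n - k` through the bijection `Lᵏ⁻ⁿ`, and degrees `k ≤ n` to `k - 2` through
`α = α₀ + L β` with `Lⁿ⁻ᵏ⁺² β = Lⁿ⁻ᵏ⁺¹ α`, `α₀` primitive. Formally:

1. `Lᵃ ∘ Lᵇ = Lᵃ⁺ᵇ` and `L⁰ = id` on a smooth projective `X` (`lefschetzPow_comp`,
   `lefschetzPow_zero`), from the axioms `cup_assoc`, `cup_comm`, `one_cup` (through
   `lefschetzPow_lefschetzPow` / `cup_pow_pow` of `LefschetzStarProofs`); hence `Lᵇ Pᵃ = 0` as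
   soon as `a + b ≥ n + 1` (`map_lefschetzPow_primitiveSubmodule_eq_bot`).
2. If `g ∘ f` is bijective then `ker g` and `range f` are complementary
   (`isCompl_ker_range_of_bijective_comp`); with `f = L : Hⁱ⁻² → Hⁱ`, `g = Lⁿ⁻ⁱ⁺¹ : Hⁱ → H²ⁿ⁻ⁱ⁺²`
   (`2 ≤ i ≤ n`, `g ∘ f = Lⁿ⁻⁽ⁱ⁻²⁾` is the hard-Lefschetz bijection) this is `Hⁱ = Pⁱ ⊕ L Hⁱ⁻²`.
3. A transport lemma for internal direct sums (`isInternal_submodule_of_injective_of_isCompl`):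
   if `M = ⨁ Aᵢ` internally, `f : M → N` is injective, and `B` is a family of submodules of `N`
   consisting of the `f(Aᵢ)`, of one complement of `range f`, and of zero submodules, then
   `N = ⨁ Bₖ` internally. Together with the degenerate case of a single summand `⊤`
   (`isInternal_submodule_of_eq_top`).
4. Strong induction on the degree `i` (`lefschetz_decomposition_holds`): `i > 2n` — `Hⁱ = 0`;
   `i ≤ 1` — `Hⁱ = Pⁱ`; `2 ≤ i ≤ n` — transport from `Hⁱ⁻²` along `L` with complement `Pⁱ` (2.);
   `n < i ≤ 2n` — transport from `H²ⁿ⁻ⁱ` along the bijection `Lⁱ⁻ⁿ`, the summands `Lᵇ Pᵃ ⊆ Hⁱ`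
   with `b < i - n` being zero by 1.

No definitions; nothing of `Lefschetz.lean` is restated or modified.

## References

* S. Kleiman, *Algebraic cycles and the Weil conjectures*, in: Dix exposés sur la cohomologie des
  schémas, North-Holland (1968), §1.4 (1.4.1). [Kleiman1968]
* C. Voisin, *Hodge theory and complex algebraic geometry I*, Cambridge Stud. Adv. Math. 76
  (2002), §6.2.2 Prop. 6.22, §6.2.3 Thm. 6.25, Cor. 6.26. [VoisinHodgeI2002]
-/

universe u v

open CategoryTheory AlgebraicGeometry
open scoped DirectSum

noncomputable section

namespace Literature.AlgebraicGeometry.Motives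

/-! ## Linear algebra: complements and internal direct sums -/

section LinearAlgebra

variable {R : Type*} [Ring R] {M N P : Type*} [AddCommGroup M] [Module R M] [AddCommGroup N]
  [Module R N] [AddCommGroup P] [Module R P]

/-- If `g ∘ f` is bijective (`f : M → N`, `g : N → P` linear) then `N = ker g ⊕ range f`:
`ker g` and `range f` are complementary submodules (for `x ∈ N` take `y` with `g (f y) = g x`;
then `x = (x - f y) + f y`). [folklore] -/
theorem isCompl_ker_range_of_bijective_comp {f : M →ₗ[R] N} {g : N →ₗ[R] P}
    (hgf : Function.Bijective (g ∘ₗ f)) : IsCompl (LinearMap.ker g) (LinearMap.range f) := by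
  refine ⟨?_, ?_⟩
  · rw [Submodule.disjoint_def]
    rintro _ hx ⟨y, rfl⟩
    rw [LinearMap.mem_ker] at hx
    have hy : y = 0 := hgf.1 (by rw [LinearMap.map_zero]; exact hx)
    rw [hy, LinearMap.map_zero]
  · rw [codisjoint_iff, eq_top_iff]
    rintro x -
    obtain ⟨y, hy⟩ := hgf.2 (g x)
    rw [Submodule.mem_sup]
    refine ⟨x - f y, ?_, f y, LinearMap.mem_range_self f y, sub_add_cancel x (f y)⟩
    rw [LinearMap.mem_ker, LinearMap.map_sub, sub_eq_zero]
    exact hy.symm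

variable {ι κ : Type*} [DecidableEq κ]

/-- A family of submodules one of which is the whole module and all the others are zero is an
internal direct sum decomposition. [folklore] -/
theorem isInternal_submodule_of_eq_top {B : κ → Submodule R N} (k₀ : κ) (h₀ : B k₀ = ⊤)
    (hbot : ∀ k, k ≠ k₀ → B k = ⊥) : DirectSum.IsInternal B := by
  rw [DirectSum.isInternal_submodule_iff_iSupIndep_and_iSup_eq_top]
  refine ⟨fun k ↦ ?_, ?_⟩
  · by_cases hk : k = k₀
    · subst hk
      refine Disjoint.mono_right ?_ disjoint_bot_right
      exact iSup₂_le fun j hj ↦ (hbot j hj).le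
    · rw [hbot k hk]
      exact disjoint_bot_left
  · rw [eq_top_iff, ← h₀]
    exact le_iSup B k₀

variable [DecidableEq ι]

/-- **Transport of internal direct sums.** Let `M = ⨁ᵢ Aᵢ` be an internal direct sum, `f : M → N`
an injective linear map, and `B` a family of submodules of `N` indexed by `κ` such that: for a map
`e : ι → κ` missing `k₀`, `B (e i) = f(Aᵢ)`; `B k₀` is a complement of `range f`; and `B k = 0`
for every other index `k`. Then `N = ⨁ₖ Bₖ` is an internal direct sum. [folklore] -/
theorem isInternal_submodule_of_injective_of_isCompl {A : ι → Submodule R M}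
    (hA : DirectSum.IsInternal A) {f : M →ₗ[R] N} (hf : Function.Injective f)
    {B : κ → Submodule R N} {e : ι → κ} {k₀ : κ} (hk₀ : ∀ i, e i ≠ k₀)
    (h₀ : IsCompl (B k₀) (LinearMap.range f)) (hB : ∀ i, B (e i) = (A i).map f)
    (hbot : ∀ k, k ≠ k₀ → (∀ i, e i ≠ k) → B k = ⊥) : DirectSum.IsInternal B := by
  rw [DirectSum.isInternal_submodule_iff_iSupIndep_and_iSup_eq_top] at hA ⊢
  obtain ⟨hAind, hAtop⟩ := hA
  have hBind : iSupIndep fun i ↦ (A i).map f := LinearMap.iSupIndep_map f hf hAind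
  -- a bound for the supremum of the summands other than `B k`
  have key : ∀ (k : κ) (Q : Submodule R N), (k ≠ k₀ → B k₀ ≤ Q) →
      (∀ i, e i ≠ k → (A i).map f ≤ Q) → ⨆ (j) (_ : j ≠ k), B j ≤ Q := by
    intro k Q hQ hQ'
    refine iSup₂_le fun j hj ↦ ?_
    by_cases hj₀ : j = k₀
    · rw [hj₀]
      exact hQ fun hk ↦ hj (hj₀.trans hk.symm)
    by_cases hje : ∃ i, e i = j
    · obtain ⟨i, rfl⟩ := hje
      rw [hB]
      exact hQ' i hj
    · push Not at hje
      rw [hbot j hj₀ hje]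
      exact bot_le
  refine ⟨fun k ↦ ?_, ?_⟩
  · by_cases hk : k = k₀
    · subst hk
      exact h₀.disjoint.mono_right
        (key k _ (fun h ↦ (h rfl).elim) fun i _ ↦ LinearMap.map_le_range)
    by_cases hke : ∃ i, e i = k
    · obtain ⟨i, rfl⟩ := hke
      have hbound : ⨆ (j) (_ : j ≠ e i), B j ≤ B k₀ ⊔ ⨆ (i') (_ : i' ≠ i), (A i').map f :=
        key (e i) _ (fun _ ↦ le_sup_left) fun i' hi' ↦
          le_sup_of_le_right (le_iSup₂_of_le i' (fun h ↦ hi' (congrArg e h)) le_rfl)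
      rw [Submodule.disjoint_def]
      intro x hx hx'
      obtain ⟨p, hp, y, hy, rfl⟩ := Submodule.mem_sup.mp (hbound hx')
      rw [hB] at hx
      have hy' : y ∈ LinearMap.range f :=
        (iSup₂_le fun i' _ ↦ LinearMap.map_le_range :
          ⨆ (i') (_ : i' ≠ i), (A i').map f ≤ LinearMap.range f) hy
      have hp' : p ∈ LinearMap.range f := by
        simpa using sub_mem (LinearMap.map_le_range hx) hy'
      obtain rfl : p = 0 := (Submodule.disjoint_def.mp h₀.disjoint) p hp hp'
      rw [zero_add] at hx ⊢
      exact (Submodule.disjoint_def.mp (hBind i)) y hx hy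
    · push Not at hke
      rw [hbot k hk hke]
      exact disjoint_bot_left
  · rw [eq_top_iff, ← h₀.sup_eq_top]
    refine sup_le (le_iSup B k₀) ?_
    rw [LinearMap.range_eq_map, ← hAtop, Submodule.map_iSup]
    exact iSup_le fun i ↦ by rw [← hB i]; exact le_iSup B (e i)

end LinearAlgebra

/-! ## Powers of the Lefschetz operator -/

namespace PreWeilCohomology

variable {k : Type u} [Field k] {K : Type v} [Field K] (W : PreWeilCohomology k K)
variable {X : SchemeOver k}

/-- `Lʳ x = x ∪ ηʳ` (unfolding of `lefschetzPow`). [folklore] -/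
lemma lefschetzPow_apply (η : W.obj X 2) {r i j : ℕ} (h : i + 2 * r = j) (x : W.obj X i) :
    W.lefschetzPow X η r i j h x = W.cup h x (W.pow X η r) := rfl

end PreWeilCohomology

namespace WeilCohomology

variable {k : Type u} [Field k] {K : Type v} [Field K] [CharZero K] (W : WeilCohomology k K)
variable {n : ℕ} {X : SchemeOver k} {η : W.obj X 2}

/-- `a ∪ 1 = a` on a smooth projective `X` (from the axioms `cup_comm`, sign `(-1)^{i·0} = 1`, and
`one_cup`). A private copy of `WeilCohomology.cup_one` of `WeilCohomologyProofs` (not imported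
here, to keep this file independent of its dimension-theory imports). [folklore] -/
private theorem cup_one_aux (hX : IsSmoothProjective n X) {i : ℕ} (h : i + 0 = i)
    (a : W.obj X i) : W.cup h a (W.one X) = a := by
  rw [W.cup_comm hX h (Nat.zero_add i) a (W.one X), W.one_cup hX (Nat.zero_add i) a]
  simp

/-- `Lᵃ ∘ Lᵇ = Lᶜ` for `b + a = c` on a smooth projective `X`, as linear maps
(`lefschetzPow_lefschetzPow` of `LefschetzStarProofs`, from `cup_assoc` and `ηᵇ ∪ ηᵃ = ηᶜ`);
degrees `i + 2b = j`, `j + 2a = m`, `i + 2c = m`. [folklore] -/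
theorem lefschetzPow_comp (hX : IsSmoothProjective n X) (η : W.obj X 2) {a b c i j m : ℕ}
    (hc : b + a = c) (h₁ : i + 2 * b = j) (h₂ : j + 2 * a = m) (h₃ : i + 2 * c = m) :
    W.lefschetzPow X η a j m h₂ ∘ₗ W.lefschetzPow X η b i j h₁ = W.lefschetzPow X η c i m h₃ :=
  LinearMap.ext fun x ↦ W.lefschetzPow_lefschetzPow hX η hc h₁ h₂ h₃ x

/-- `L⁰ = id` on `Hⁱ(X)` for a smooth projective `X`, as linear maps (`x ∪ η⁰ = x ∪ 1 = x`;
cf. `lefschetzPow_zero_apply` of `WeilCohomologyProofs`). [folklore] -/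
theorem lefschetzPow_zero (hX : IsSmoothProjective n X) (η : W.obj X 2) {i : ℕ}
    (h : i + 2 * 0 = i) : W.lefschetzPow X η 0 i i h = LinearMap.id := by
  ext x
  rw [PreWeilCohomology.lefschetzPow_apply, PreWeilCohomology.pow_zero]
  exact W.cup_one_aux hX h x

/-- A primitive class `x ∈ Pᵃ(X)` (`X` smooth projective of dimension `n`) is killed by `Lᵇ` as
soon as `a + b ≥ n + 1`: for `a > n` it is zero by definition, and for `a ≤ n`,
`Lᵇ x = Lᵇ⁻⁽ⁿ⁻ᵃ⁺¹⁾ (Lⁿ⁻ᵃ⁺¹ x) = 0`. [folklore] -/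
theorem lefschetzPow_eq_zero_of_isPrimitive (hX : IsSmoothProjective n X) (η : W.obj X 2)
    {a : ℕ} {x : W.obj X a} (hx : W.IsPrimitive n η x) {b j : ℕ} (h : a + 2 * b = j)
    (hb : n + 1 ≤ a + b) : W.lefschetzPow X η b a j h x = 0 := by
  by_cases ha : n < a
  · rw [hx.1 ha, LinearMap.map_zero]
  · obtain ⟨r, hr⟩ : ∃ r, a + r = n + 1 := ⟨n + 1 - a, by omega⟩
    obtain ⟨s, rfl⟩ : ∃ s, b = r + s := ⟨b - r, by omega⟩
    rw [← W.lefschetzPow_lefschetzPow hX η rfl rfl (show a + 2 * r + 2 * s = j by omega) h x,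
      hx.2 r _ rfl hr, LinearMap.map_zero]

/-- `Lᵇ Pᵃ(X) = 0` in `Hʲ(X)` (`a + 2b = j`) whenever `a + b ≥ n + 1`, `X` smooth projective of
dimension `n` (`lefschetzPow_eq_zero_of_isPrimitive`): the would-be Lefschetz summands beyond the
range `a ≤ n`, `b ≤ n - a` vanish. [folklore] -/
theorem map_lefschetzPow_primitiveSubmodule_eq_bot (hX : IsSmoothProjective n X) (η : W.obj X 2)
    {a b j : ℕ} (h : a + 2 * b = j) (hb : n + 1 ≤ a + b) :
    (W.primitiveSubmodule X n η a).map (W.lefschetzPow X η b a j h) = ⊥ := by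
  rw [eq_bot_iff]
  rintro _ ⟨x, hx, rfl⟩
  rw [Submodule.mem_bot]
  exact W.lefschetzPow_eq_zero_of_isPrimitive hX η hx h hb

/-! ## The Lefschetz decomposition -/

/-- The degenerate case of the Lefschetz decomposition: if `Pⁱ(X) = Hⁱ(X)` and all the would-be
summands `Lᵇ Pᵃ`, `a + 2b = i`, `b ≥ 1` vanish, then `Hⁱ(X) = ⨁_{a + 2b = i} Lᵇ Pᵃ(X)` (the
single nonzero summand being `L⁰ Pⁱ = Pⁱ`). Used in degrees `i ≤ 1` and `i > 2n`. [folklore] -/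
theorem isInternal_lefschetz_base (hX : IsSmoothProjective n X) (η : W.obj X 2) {i : ℕ}
    (htop : W.primitiveSubmodule X n η i = ⊤)
    (hbot : ∀ (a b : ℕ) (h : a + 2 * b = i), 1 ≤ b →
      (W.primitiveSubmodule X n η a).map (W.lefschetzPow X η b a i h) = ⊥) :
    DirectSum.IsInternal fun p : {p : ℕ × ℕ // p.1 + 2 * p.2 = i} ↦
      (W.primitiveSubmodule X n η p.1.1).map (W.lefschetzPow X η p.1.2 p.1.1 i p.2) := by
  refine isInternal_submodule_of_eq_top ⟨(i, 0), by simp⟩ ?_ ?_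
  · show (W.primitiveSubmodule X n η i).map (W.lefschetzPow X η 0 i i _) = ⊤
    rw [W.lefschetzPow_zero hX η, Submodule.map_id, htop]
  · rintro ⟨⟨a, b⟩, hab⟩ hk
    have hab' : a + 2 * b = i := hab
    refine hbot a b hab' ?_
    rcases Nat.eq_zero_or_pos b with rfl | hb
    · exfalso
      apply hk
      obtain rfl : a = i := by omega
      rfl
    · exact hb

/-- The inductive step of the Lefschetz decomposition, as a transport statement: let `i₀ + 2s = i`
with `s ≥ 1`, suppose `Hⁱ⁰(X) = ⨁_{a + 2b = i₀} Lᵇ Pᵃ(X)`, that `Lˢ : Hⁱ⁰(X) → Hⁱ(X)` is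
injective with `Hⁱ(X) = Pⁱ(X) ⊕ Lˢ Hⁱ⁰(X)`, and that the summands `Lᵇ Pᵃ ⊆ Hⁱ(X)` with
`1 ≤ b < s` vanish. Then `Hⁱ(X) = ⨁_{a + 2b = i} Lᵇ Pᵃ(X)` (transport along `Lˢ`, the index
`(a, b)` going to `(a, b + s)`, by `Lˢ ∘ Lᵇ = Lᵇ⁺ˢ`). Used with `s = 1` for `2 ≤ i ≤ n` and with
`s = i - n` for `n < i ≤ 2n` (Voisin 2002, proof of Prop. 6.22). [folklore] -/
theorem isInternal_lefschetz_step (hX : IsSmoothProjective n X) (η : W.obj X 2) {i₀ s i : ℕ}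
    (hs : 1 ≤ s) (hi : i₀ + 2 * s = i)
    (ih : DirectSum.IsInternal fun p : {p : ℕ × ℕ // p.1 + 2 * p.2 = i₀} ↦
      (W.primitiveSubmodule X n η p.1.1).map (W.lefschetzPow X η p.1.2 p.1.1 i₀ p.2))
    (hinj : Function.Injective (W.lefschetzPow X η s i₀ i hi))
    (hcompl : IsCompl (W.primitiveSubmodule X n η i)
      (LinearMap.range (W.lefschetzPow X η s i₀ i hi)))
    (hbot : ∀ (a b : ℕ) (h : a + 2 * b = i), 1 ≤ b → b < s →
      (W.primitiveSubmodule X n η a).map (W.lefschetzPow X η b a i h) = ⊥) :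
    DirectSum.IsInternal fun p : {p : ℕ × ℕ // p.1 + 2 * p.2 = i} ↦
      (W.primitiveSubmodule X n η p.1.1).map (W.lefschetzPow X η p.1.2 p.1.1 i p.2) := by
  refine isInternal_submodule_of_injective_of_isCompl ih hinj
    (e := fun p ↦ ⟨(p.1.1, p.1.2 + s), by have := p.2; dsimp only; omega⟩)
    (k₀ := ⟨(i, 0), by simp⟩) ?_ ?_ ?_ ?_
  · intro p hp
    have h2 := congrArg (fun q : {p : ℕ × ℕ // p.1 + 2 * p.2 = i} ↦ q.1.2) hp
    dsimp only at h2
    omega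
  · show IsCompl ((W.primitiveSubmodule X n η i).map (W.lefschetzPow X η 0 i i _)) _
    rwa [W.lefschetzPow_zero hX η, Submodule.map_id]
  · intro p
    show (W.primitiveSubmodule X n η p.1.1).map (W.lefschetzPow X η (p.1.2 + s) p.1.1 i _) =
      ((W.primitiveSubmodule X n η p.1.1).map _).map _
    rw [← Submodule.map_comp, W.lefschetzPow_comp hX η rfl p.2 hi]
  · rintro ⟨⟨a, b⟩, hab⟩ hk₀ hke
    have hab' : a + 2 * b = i := hab
    refine hbot a b hab' ?_ ?_
    · rcases Nat.eq_zero_or_pos b with rfl | hb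
      · exfalso
        apply hk₀
        obtain rfl : a = i := by omega
        rfl
      · exact hb
    · by_contra hbs
      obtain ⟨b', rfl⟩ : ∃ b', b = b' + s := ⟨b - s, by omega⟩
      exact hke ⟨(a, b'), by dsimp only; omega⟩ rfl

/-- **Lefschetz decomposition** — discharge of the named fact
`WeilCohomology.lefschetz_decomposition` (Kleiman 1968 1.4.1; Kleiman 1994 §4): for a Weil
cohomology theory `W` with the hard Lefschetz property, `X` smooth projective of dimension `n` and
`η` a hyperplane class, `Hⁱ(X) = ⨁_{a + 2b = i} Lᵇ Pᵃ(X)` is an internal direct sum for every `i`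
(the summands with `a + b > n` being zero). Proof by strong induction on `i`, following Voisin
2002, Prop. 6.22 / Cor. 6.26: `i > 2n` — `Hⁱ = 0`; `i ≤ 1` — `Hⁱ = Pⁱ`
(`primitivePart_eq_top_of_le_one`); `2 ≤ i ≤ n` — `Hⁱ = Pⁱ ⊕ L Hⁱ⁻²` since
`Lⁿ⁻ⁱ⁺² = Lⁿ⁻ⁱ⁺¹ ∘ L : Hⁱ⁻² → H²ⁿ⁻ⁱ⁺²` is the hard-Lefschetz bijection
(`isCompl_ker_range_of_bijective_comp`), then transport of the decomposition of `Hⁱ⁻²` along the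
injection `L` (`isInternal_lefschetz_step`); `n < i ≤ 2n` — transport of the decomposition of
`H²ⁿ⁻ⁱ` along the hard-Lefschetz bijection `Lⁱ⁻ⁿ : H²ⁿ⁻ⁱ → Hⁱ`, the summands `Lᵇ Pᵃ ⊆ Hⁱ` with
`b < i - n` (i.e. `a + b > n`) being zero. [cite: Kleiman1968, §1.4 (1.4.1)] -/
theorem lefschetz_decomposition_holds : W.lefschetz_decomposition (n := n) (X := X) (η := η) := by
  intro hL hX hη i
  induction i using Nat.strong_induction_on with | _ i ih => ?_
  rcases lt_or_ge (2 * n) i with hi2 | hi2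
  · -- `i > 2n`: `Hⁱ(X) = 0`
    haveI := W.subsingleton_obj hX hi2
    haveI := (Submodule.subsingleton_iff K).mpr (W.subsingleton_obj hX hi2)
    exact W.isInternal_lefschetz_base hX η (Subsingleton.elim _ _) fun _ _ _ _ ↦ Subsingleton.elim _ _
  rcases le_or_gt i 1 with hi1 | hi1
  · -- `i ≤ 1`: `Hⁱ(X) = Pⁱ(X)`
    have hin : i ≤ n := by omega
    obtain ⟨r, hr⟩ : ∃ r, i + r = n + 1 := ⟨n + 1 - i, by omega⟩
    refine W.isInternal_lefschetz_base hX η ?_ fun a b h hb ↦ ?_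
    · rw [W.primitiveSubmodule_eq_primitivePart X n η hin hr rfl]
      exact W.primitivePart_eq_top_of_le_one hX η hi1 hr rfl
    · exfalso
      omega
  rcases le_or_gt i n with hin | hin
  · -- `2 ≤ i ≤ n`: `Hⁱ = Pⁱ ⊕ L Hⁱ⁻²`, transport from `Hⁱ⁻²` along `L`
    obtain ⟨i₀, rfl⟩ : ∃ i₀, i = i₀ + 2 := ⟨i - 2, by omega⟩
    obtain ⟨r, hr⟩ : ∃ r, i₀ + 2 + r = n + 1 := ⟨n + 1 - (i₀ + 2), by omega⟩
    have hbij : Function.Bijective (W.lefschetzPow X η r (i₀ + 2) (i₀ + 2 + 2 * r) rfl ∘ₗ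
        W.lefschetzPow X η 1 i₀ (i₀ + 2) rfl) := by
      rw [W.lefschetzPow_comp hX η (show 1 + r = r + 1 by omega) rfl rfl
        (show i₀ + 2 * (r + 1) = i₀ + 2 + 2 * r by omega)]
      exact hL hX η hη i₀ (r + 1) _ (by omega) _
    have hinj : Function.Injective (W.lefschetzPow X η 1 i₀ (i₀ + 2) rfl) := by
      have h1 := hbij.1
      rw [LinearMap.coe_comp] at h1
      exact h1.of_comp
    refine W.isInternal_lefschetz_step hX η le_rfl rfl (ih i₀ (by omega)) hinj ?_
      fun a b h hb hbs ↦ ?_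
    · rw [W.primitiveSubmodule_eq_primitivePart X n η hin hr rfl]
      exact isCompl_ker_range_of_bijective_comp hbij
    · exfalso
      omega
  · -- `n < i ≤ 2n`: transport from `H²ⁿ⁻ⁱ` along the bijection `Lⁱ⁻ⁿ`
    obtain ⟨s, rfl⟩ : ∃ s, i = n + s := ⟨i - n, by omega⟩
    obtain ⟨i₀, hi₀⟩ : ∃ i₀, i₀ + s = n := ⟨n - s, by omega⟩
    have hi : i₀ + 2 * s = n + s := by omega
    have hbij := hL hX η hη i₀ s (n + s) hi₀ hi
    refine W.isInternal_lefschetz_step hX η (by omega) hi (ih i₀ (by omega)) hbij.1 ?_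
      fun a b h hb hbs ↦ ?_
    · have hP : W.primitiveSubmodule X n η (n + s) = ⊥ := by
        rw [eq_bot_iff]
        intro x hx
        exact (Submodule.mem_bot K).mpr (hx.1 (by omega))
      rw [hP, LinearMap.range_eq_top.mpr hbij.2]
      exact isCompl_bot_top
    · exact W.map_lefschetzPow_primitiveSubmodule_eq_bot hX η h (by omega)

end WeilCohomology

end Literature.AlgebraicGeometry.Motives

end
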